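import Literature.AlgebraicGeometry.Motives.SeesawChartRepr
import Literature.AlgebraicGeometry.Motives.SeesawChartLink
import Literature.AlgebraicGeometry.Motives.SeesawSubschemeGlobal
import Literature.AlgebraicGeometry.Motives.SeesawIdealGluing
import Literature.AlgebraicGeometry.Motives.SeesawTrivFromBaseLocal
import HarnessLib

/-!
# The seesaw closed subscheme: a finite basic-open subcover of charts, the glued ideal, and `N1cLocal`

[MumfordAV1970] §10 (p. 89) / [GortzWedhorn2023] Thm. 24.66, end of the LOCAL half: on an affine open `U ⊆ W` with ring
`A = Γ(W, U)`, the charts at every prime (`exists_chartProp_at` of `SeesawChartRepr`) give a finite basic-open subcover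
`D(f₁), …, D(f_n)` with ideals `J_i ⊆ A_{f_i}` representing `Triv` on `A_{f_i}`-algebras; `Triv` is stable under base
change and Zariski-local (`SeesawChartLink`), so the ideals glue (★ `SeesawIdealGluing.exists_ideal_forall_triv_iff`)
to ONE ideal `J ⊆ A` with `Triv X 𝓕 U B ↔ J·B = 0` for every `A`-algebra `B`, i.e. (`isReprIdeal_of_forall_triv_iff`)
a representing ideal: **`exists_isReprIdeal`**, hence `n1cLocal_of_repr : … → N1cLocal` and, with the global half
(`SeesawSubschemeGlobal`), `exists_seesawSubscheme_of_repr` — the seesaw closed subscheme for ALL test schemes `S/ℂ`,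
with the representing modules `H0Repr`/`DualRepr` as the only remaining hypotheses (`N1cDelta` is ★
`n1cDelta_holds`; the fibre inputs and the base change of the pairing are ★ `SeesawChartFibreCyclic`).
(Cell `hodgecm-mathlib`, M13 node N1, file S8 of the split plan; HOME certificate `B-plan/m13-glue/N1-Assembly.v9.B-p01g12.lean`
164baf9abb46c288 PART III §16 — decls token-identical except that every v9 hypothesis with a ★ provider (`idealGluing`,
`N1cDelta`, bricks, fibre statements) is discharged by name; heads renamed `…_of_repr`.)

## References
* [MumfordAV1970] D. Mumford, *Abelian Varieties* (1970), §10 p. 89.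
* [GortzWedhorn2023] U. Görtz, T. Wedhorn, *Algebraic Geometry II* (2023), Thm. 24.66 (p. 405; proof pp. 407–408).
-/

set_option autoImplicit false

noncomputable section

-- `TopCat.Presheaf`/`Scheme.Modules` are not reducible (as in Mathlib's `AlgebraicGeometry/Modules`).
set_option backward.isDefEq.respectTransparency false

open CategoryTheory CategoryTheory.Limits AlgebraicGeometry MonoidalCategory CartesianMonoidalCategory
  Opposite
open scoped TensorProduct

namespace Literature.AlgebraicGeometry.Motives

namespace SeesawSubscheme

open Literature.AlgebraicGeometry.Modules

variable (X : SchemeOver ℂ) {W : SchemeOver ℂ} (𝓕 : (X ⊗ W).left.Modules) (U : W.left.affineOpens)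


section Charts

variable {X 𝓕 U}

/-! ## A finite basic-open subcover, the glued ideal, and `N1cLocal` -/

/-- A chart representability on `A_f`-algebras in the `compAlgebra` shape gives it for every COMPATIBLE pair of
algebra structures (the binder shape of the gluing theorem). [cite: MumfordAV1970, §10 (p. 89)] -/
theorem ChartProp.of_isScalarTower {f : Γ(W.left, U)} {J : Ideal (Localization.Away f)}
    (h : ChartProp (X := X) (𝓕 := 𝓕) f J) (B : Type) [CommRing B] [inst : Algebra Γ(W.left, U) B]
    [Algebra (Localization.Away f) B] [IsScalarTower Γ(W.left, U) (Localization.Away f) B] :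
    Triv X 𝓕 U B ↔ J.map (algebraMap (Localization.Away f) B) = ⊥ := by
  have hinst : inst = compAlgebra U f B :=
    Algebra.algebra_ext _ _ fun a => IsScalarTower.algebraMap_apply Γ(W.left, U) (Localization.Away f) B a
  subst hinst
  exact h B

/-- A TOTAL family of chart ideals (`⊤` where no chart is known; non-Prop bookkeeping). [folklore] -/
def chartIdeal (f : Γ(W.left, U)) : Ideal (Localization.Away f) := by
  classical
  exact if h : ∃ J, ChartProp (X := X) (𝓕 := 𝓕) f J then Classical.choose h else ⊤

/-- `chartIdeal f` is a chart ideal whenever one exists. [cite: MumfordAV1970, §10 (p. 89)] -/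
theorem chartProp_chartIdeal {f : Γ(W.left, U)} (h : ∃ J, ChartProp (X := X) (𝓕 := 𝓕) f J) :
    ChartProp (X := X) (𝓕 := 𝓕) f (chartIdeal (X := X) (𝓕 := 𝓕) f) := by
  classical
  unfold chartIdeal
  rw [dif_pos h]
  exact Classical.choose_spec h

/-- **THE AFFINE-LOCAL SEESAW IDEAL EXISTS** ([MumfordAV1970] §10 p. 89): charts at every
prime (`exists_chartProp_at`) ⇒ a finite basic-open subcover ⇒ the glued ideal (★ `exists_ideal_forall_triv_iff`, with
(M0) `Triv.of_isScalarTower` and (M0′) `Triv.of_away_cover`) represents `Triv` on all `A`-algebras ⇒ (§11)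
it is the representing ideal `IsReprIdeal`. [cite: MumfordAV1970, §10 (p. 89)]
[cite: GortzWedhorn2023, Thm. 24.66, proof (pp. 407–408)] -/
theorem exists_isReprIdeal_of_repr [IsProper X.hom] [GeometricallyIntegral X.hom] [𝓕.IsQuasicoherent]
    (h𝓕 : HasRank 𝓕 1) (hR : H0Repr X 𝓕 U) (hR' : DualRepr X 𝓕 U h𝓕) :
    ∃ J : Ideal Γ(W.left, U), IsReprIdeal X 𝓕 U J := by
  classical
  choose f hf hJ using fun 𝔭 : PrimeSpectrum Γ(W.left, U) =>
    exists_chartProp_at h𝓕 hR hR' 𝔭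
  -- the basic opens `D(f_𝔭)` cover `Spec A`
  have hspan : Ideal.span (Set.range f) = ⊤ := by
    by_contra hne
    obtain ⟨𝔪, h𝔪, hle⟩ := Ideal.exists_le_maximal _ hne
    exact hf ⟨𝔪, h𝔪.isPrime⟩ (hle (Ideal.subset_span ⟨_, rfl⟩))
  -- a finite subcover
  obtain ⟨t, ht, hspan_t⟩ : ∃ t : Finset Γ(W.left, U), ↑t ⊆ Set.range f ∧ Ideal.span (t : Set Γ(W.left, U)) = ⊤ := by
    have h1 : (1 : Γ(W.left, U)) ∈ Ideal.span (Set.range f) := hspan ▸ Submodule.mem_top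
    obtain ⟨t, ht, h1t⟩ := Submodule.mem_span_finite_of_mem_span h1
    exact ⟨t, ht, (Ideal.eq_top_iff_one _).mpr h1t⟩
  -- glue
  obtain ⟨J, hJiff⟩ := exists_ideal_forall_triv_iff (fun B _ _ => Triv X 𝓕 U B) t
    (fun g => chartIdeal (X := X) (𝓕 := 𝓕) g)
    (fun g hg B _ _ _ _ => by
      obtain ⟨𝔭, rfl⟩ := ht hg
      exact (chartProp_chartIdeal (hJ 𝔭)).of_isScalarTower B)
    (fun B _ _ C _ _ _ _ hB => Triv.of_isScalarTower X 𝓕 U B C hB)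
    (fun B _ _ s hs h => Triv.of_away_cover X 𝓕 U n1cDelta_holds h𝓕 B s hs h) hspan_t
  exact ⟨J, isReprIdeal_of_forall_triv_iff X 𝓕 U J hJiff⟩

/-- **`N1cLocal`** — the local half of [MumfordAV1970] §10 p. 89 for every proper geometrically
integral `X/ℂ`, every `W` locally of finite type, every quasi-coherent rank-one `𝓕` on `X × W` and every affine
open `U ⊆ W`, from the representing modules `H0Repr`/`DualRepr`. [cite: MumfordAV1970, §10 (p. 89)] -/
theorem n1cLocal_of_repr
    (hX : ∀ (X : SchemeOver ℂ) [IsProper X.hom] [GeometricallyIntegral X.hom] (W : SchemeOver ℂ)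
      [LocallyOfFiniteType W.hom] (𝓕 : (X ⊗ W).left.Modules) [𝓕.IsQuasicoherent] (h𝓕 : HasRank 𝓕 1)
      (U : W.left.affineOpens), H0Repr X 𝓕 U ∧ DualRepr X 𝓕 U h𝓕) :
    N1cLocal := by
  intro X _ _ _ W _ 𝓕 _ h𝓕 U
  obtain ⟨hR, hR'⟩ := hX X W 𝓕 h𝓕 U
  exact exists_isReprIdeal_of_repr h𝓕 hR hR'

/-- **THE SEESAW CLOSED SUBSCHEME from the per-chart inputs** — global half `exists_seesawSubscheme_of_sockets`
composed with `n1cLocal_of_repr`: [MumfordAV1970] §10 p. 89 for `X` proper geometrically integral over `ℂ` with a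
point, `W` locally of finite type, `𝓕` quasi-coherent of rank one on `X × W`, for every test scheme `S/ℂ`.
[cite: MumfordAV1970, §10 (p. 89)] -/
theorem exists_seesawSubscheme_of_repr
    (hX : ∀ (X : SchemeOver ℂ) [IsProper X.hom] [GeometricallyIntegral X.hom] (W : SchemeOver ℂ)
      [LocallyOfFiniteType W.hom] (𝓕 : (X ⊗ W).left.Modules) [𝓕.IsQuasicoherent] (h𝓕 : HasRank 𝓕 1)
      (U : W.left.affineOpens), H0Repr X 𝓕 U ∧ DualRepr X 𝓕 U h𝓕)
    (X : SchemeOver ℂ) [IsProper X.hom] [GeometricallyIntegral X.hom] (x₀ : 𝟙_ (SchemeOver ℂ) ⟶ X)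
    (W : SchemeOver ℂ) [LocallyOfFiniteType W.hom] (𝓕 : (X ⊗ W).left.Modules) [𝓕.IsQuasicoherent]
    (h𝓕 : HasRank 𝓕 1) :
    ∃ (Z : SchemeOver ℂ) (i : Z ⟶ W) (_ : IsClosedImmersion i.left),
      ∀ (S : SchemeOver ℂ) (u : S ⟶ W),
        (∃ v : S ⟶ Z, v ≫ i = u) ↔
          ∃ (𝓜 : S.left.Modules) (_ : 𝓜.IsQuasicoherent) (_ : HasRank 𝓜 1),
            Nonempty ((Scheme.Modules.pullback (X ◁ u).left).obj 𝓕 ≅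
              (Scheme.Modules.pullback (CartesianMonoidalCategory.snd X S).left).obj 𝓜) :=
  exists_seesawSubscheme_of_sockets (n1cLocal_of_repr hX) n1cDelta_holds X x₀ W 𝓕 h𝓕


end Charts

end SeesawSubscheme

end Literature.AlgebraicGeometry.Motives

end
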